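import Literature.NumberTheory.ModularForms.QAsymptotics
import Literature.NumberTheory.ModularForms.ModerateGrowth
import HarnessLib

/-!
# From asymptotics at `i∞` to uniform bounds on half-planes `Im τ ≥ δ` (tool for CKMRV Lemma 4.9)

Cohn–Kumar–Miller–Radchenko–Viazovska, arXiv:1902.05438, Lemma 4.9 asks for bounds holding
uniformly for `Im τ, Im z ≥ δ` ("for each `δ > 0` … there exists a constant `C = C_{γ,δ}`"),
whereas `q`-expansion calculations give estimates as `Im τ → ∞`. For PERIODIC continuous
functions the passage is formal: a continuous `h`-periodic `F : ℍ → ℂ` is bounded on every strip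
`δ ≤ Im τ ≤ A` (compactness of `[0,h] × [δ,A]`), so an estimate `‖F‖ ≤ C·g` valid for `Im τ ≥ A`
extends to `Im τ ≥ δ` as soon as `g` is bounded below by a positive constant on the strip.

Everything below is proved: `apply_int_mul_vadd_of_periodic`, `exists_bound_on_strip_of_periodic`,
the uniformization lemma `uniform_bound_of_periodic_isBigO`, and its instances for the comparison
functions `e^{−cy}` (`uniform_bound_of_periodic_isBigO_exp`).

## References

* H. Cohn, A. Kumar, S. D. Miller, D. Radchenko, M. Viazovska, Ann. of Math. 196 (2022),
  arXiv:1902.05438, Lemma 4.9. [CohnEtAl2019]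
-/

noncomputable section

open Complex hiding I
open Filter Topology Asymptotics
open UpperHalfPlane hiding I
open Complex (I)
open scoped Real

namespace Literature.NumberTheory.ModularForms

/-- Iterating an `h`-periodicity: `F((nh) +ᵥ τ) = F(τ)` for `n ∈ ℤ`. [folklore] -/
theorem apply_int_mul_vadd_of_periodic {F : ℍ → ℂ} {h : ℝ} (hper : ∀ τ : ℍ, F (h +ᵥ τ) = F τ) (n : ℤ) (τ : ℍ) :
    F (((n : ℝ) * h) +ᵥ τ) = F τ := by
  -- reduce to natural numbers in both directions
  have hnat : ∀ (m : ℕ) (σ : ℍ), F (((m : ℝ) * h) +ᵥ σ) = F σ := by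
    intro m
    induction m with
    | zero => intro σ; simp
    | succ m ih =>
      intro σ
      have : (((m + 1 : ℕ) : ℝ) * h) +ᵥ σ = h +ᵥ ((((m : ℕ) : ℝ) * h) +ᵥ σ) := by
        rw [vadd_vadd]; congr 1; push_cast; ring
      rw [this, hper, ih]
  have hneg : ∀ σ : ℍ, F ((-h) +ᵥ σ) = F σ := by
    intro σ
    have := hper ((-h) +ᵥ σ)
    rw [vadd_vadd, add_neg_cancel, zero_vadd] at this
    exact this.symm
  have hnat' : ∀ (m : ℕ) (σ : ℍ), F ((-((m : ℝ) * h)) +ᵥ σ) = F σ := by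
    intro m
    induction m with
    | zero => intro σ; simp
    | succ m ih =>
      intro σ
      have : (-(((m + 1 : ℕ) : ℝ) * h)) +ᵥ σ = (-h) +ᵥ ((-(((m : ℕ) : ℝ) * h)) +ᵥ σ) := by
        rw [vadd_vadd]; congr 1; push_cast; ring
      rw [this, hneg, ih]
  rcases Int.eq_nat_or_neg n with ⟨m, rfl | rfl⟩
  · simpa using hnat m τ
  · have := hnat' m τ
    simpa using this

/-- **A continuous `h`-periodic function on `ℍ` is bounded on every strip `δ ≤ Im τ ≤ A`
(`δ > 0`).** [folklore] -/
theorem exists_bound_on_strip_of_periodic {F : ℍ → ℂ} (hcont : Continuous F) {h : ℝ} (hh : 0 < h)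
    (hper : ∀ τ : ℍ, F (h +ᵥ τ) = F τ) {δ : ℝ} (hδ : 0 < δ) (A : ℝ) :
    ∃ M : ℝ, ∀ τ : ℍ, δ ≤ τ.im → τ.im ≤ A → ‖F τ‖ ≤ M := by
  set K : Set ℂ := Set.Icc (0 : ℝ) h ×ℂ Set.Icc δ A with hK
  have hKc : IsCompact K := isCompact_Icc.reProdIm isCompact_Icc
  have hKsub : K ⊆ Set.range ((↑) : ℍ → ℂ) := by
    intro z hz
    have hz' : 0 < z.im := hδ.trans_le (mem_reProdIm.1 hz).2.1
    exact ⟨⟨z, hz'⟩, rfl⟩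
  have hGK : ContinuousOn (F ∘ ofComplex) K := by
    refine hcont.comp_continuousOn (ofComplex.continuousOn.mono ?_)
    intro z hz
    simpa [ofComplex] using hKsub hz
  obtain ⟨M, hM⟩ := hKc.exists_bound_of_continuousOn hGK
  refine ⟨M, fun τ hτ hτA => ?_⟩
  -- translate `τ` into the box by a multiple of `h`
  set n : ℤ := ⌊τ.re / h⌋ with hn
  set τ₀ : ℍ := (((-n : ℤ) : ℝ) * h) +ᵥ τ with hτ₀
  have hF : F τ₀ = F τ := by
    have := apply_int_mul_vadd_of_periodic hper (-n) τ
    rw [hτ₀]; push_cast at this ⊢; exact this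
  have hmem : (τ₀ : ℂ) ∈ K := by
    refine mem_reProdIm.2 ⟨?_, ?_⟩
    · rw [coe_re, hτ₀, vadd_re]
      push_cast
      have h1 := Int.floor_le (τ.re / h)
      have h2 := Int.lt_floor_add_one (τ.re / h)
      rw [← hn] at h1 h2
      constructor
      · have : (n : ℝ) * h ≤ τ.re := by rwa [le_div_iff₀ hh] at h1
        linarith
      · have : τ.re < ((n : ℝ) + 1) * h := by rwa [div_lt_iff₀ hh] at h2
        linarith
    · rw [coe_im, hτ₀, vadd_im]
      exact ⟨hτ, hτA⟩
  have := hM _ hmem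
  rw [Function.comp_apply, ofComplex_apply, hF] at this
  exact this

/-- **Uniformization.** Let `F : ℍ → ℂ` be continuous and `h`-periodic, `g : ℍ → ℝ` bounded below by
a positive constant on every strip `δ ≤ Im τ ≤ A`, and `F = O(g)` along `atImInfty`. Then for every
`δ > 0` there is `C` with `‖F τ‖ ≤ C·g τ` for all `Im τ ≥ δ`. [folklore] -/
theorem uniform_bound_of_periodic_isBigO {F : ℍ → ℂ} {g : ℍ → ℝ} (hcont : Continuous F) {h : ℝ} (hh : 0 < h)
    (hper : ∀ τ : ℍ, F (h +ᵥ τ) = F τ) (hO : F =O[atImInfty] g)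
    (hg : ∀ δ A : ℝ, 0 < δ → ∃ c : ℝ, 0 < c ∧ ∀ τ : ℍ, δ ≤ τ.im → τ.im ≤ A → c ≤ g τ)
    {δ : ℝ} (hδ : 0 < δ) : ∃ C : ℝ, ∀ τ : ℍ, δ ≤ τ.im → ‖F τ‖ ≤ C * g τ := by
  obtain ⟨C₀, hC₀⟩ := hO.bound
  rw [Filter.Eventually, atImInfty_mem] at hC₀
  obtain ⟨A, hA⟩ := hC₀
  obtain ⟨M, hM⟩ := exists_bound_on_strip_of_periodic hcont hh hper hδ A
  obtain ⟨c, hc, hcg⟩ := hg δ A hδ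
  refine ⟨max (max C₀ 0) (max M 0 / c), fun τ hτ => ?_⟩
  rcases le_total A τ.im with hτA | hτA
  · have h1 := hA τ hτA
    simp only [Set.mem_setOf_eq] at h1
    have hg0 : ‖g τ‖ = g τ ∨ g τ < 0 := by
      rcases le_or_gt 0 (g τ) with h | h
      · exact Or.inl (Real.norm_of_nonneg h)
      · exact Or.inr h
    rcases hg0 with h | h
    · rw [h] at h1
      calc ‖F τ‖ ≤ C₀ * g τ := h1
        _ ≤ max C₀ 0 * g τ := by
            have : 0 ≤ g τ := by rw [← h]; exact norm_nonneg _
            exact mul_le_mul_of_nonneg_right (le_max_left _ _) this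
        _ ≤ max (max C₀ 0) (max M 0 / c) * g τ := by
            have : 0 ≤ g τ := by rw [← h]; exact norm_nonneg _
            exact mul_le_mul_of_nonneg_right (le_max_left _ _) this
    · -- `g τ < 0` cannot happen where `‖F‖ ≤ C₀‖g‖`... but we only need some bound: use the strip bound at `A`?
      -- Since `g` is bounded below by `c > 0` on `[δ, im τ]`-strips, `g τ ≥ c > 0`:
      obtain ⟨c', hc', hcg'⟩ := hg δ τ.im hδ
      have := hcg' τ hτ le_rfl
      linarith
  · have h1 := hM τ hτ hτA
    have h2 := hcg τ hτ hτA
    calc ‖F τ‖ ≤ max M 0 := h1.trans (le_max_left _ _)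
      _ = max M 0 / c * c := by field_simp
      _ ≤ max M 0 / c * g τ := mul_le_mul_of_nonneg_left h2 (div_nonneg (le_max_right _ _) hc.le)
      _ ≤ max (max C₀ 0) (max M 0 / c) * g τ :=
          mul_le_mul_of_nonneg_right (le_max_right _ _) (hc.le.trans h2)

/-- The comparison functions `e^{−aπy}` (`a ≥ 0`) are bounded below on strips. [folklore] -/
theorem exp_lower_bound_on_strip (a : ℝ) (ha : 0 ≤ a) (δ A : ℝ) :
    ∃ c : ℝ, 0 < c ∧ ∀ τ : ℍ, δ ≤ τ.im → τ.im ≤ A → c ≤ Real.exp (-a * π * τ.im) := by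
  refine ⟨Real.exp (-a * π * max A δ), Real.exp_pos _, fun τ _ hτA => ?_⟩
  rw [Real.exp_le_exp]
  have : τ.im ≤ max A δ := hτA.trans (le_max_left _ _)
  nlinarith [Real.pi_pos, mul_nonneg ha Real.pi_pos.le]

/-- **Uniformization for `g = expDecayHalfⁿ = e^{−nπy}`**: a continuous `h`-periodic `F` with
`F = O(e^{−nπy})` at `i∞` satisfies `‖F τ‖ ≤ C_δ e^{−nπ Im τ}` on `Im τ ≥ δ`. [folklore] -/
theorem uniform_bound_of_periodic_isBigO_exp {F : ℍ → ℂ} (hcont : Continuous F) {h : ℝ} (hh : 0 < h)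
    (hper : ∀ τ : ℍ, F (h +ᵥ τ) = F τ) (n : ℕ) (hO : F =O[atImInfty] fun τ => expDecayHalf τ ^ n)
    {δ : ℝ} (hδ : 0 < δ) : ∃ C : ℝ, ∀ τ : ℍ, δ ≤ τ.im → ‖F τ‖ ≤ C * expDecayHalf τ ^ n := by
  refine uniform_bound_of_periodic_isBigO hcont hh hper hO (fun δ' A _ => ?_) hδ
  obtain ⟨c, hc, hcg⟩ := exp_lower_bound_on_strip n (Nat.cast_nonneg n) δ' A
  refine ⟨c, hc, fun τ h1 h2 => ?_⟩
  have := hcg τ h1 h2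
  rw [expDecayHalf, ← Real.exp_nat_mul]
  convert this using 2
  ring

end Literature.NumberTheory.ModularForms
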